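import Literature.AnabelianGeometry.SemiGraphs.ArithThm54CapstonesChartOfProducers
import Literature.AnabelianGeometry.SemiGraphs.ArithThm54CapstoneCorollaryTopology
import HarnessLib

/-!
# [SemiAnbd] Thm 5.4 (i) ∧ (ii) AT `π₁^temp(𝒢) ⋊^out Π_A` FOR THE CHART OF A COFINAL GALOIS TOWER WITH
# CHARACTERISTIC LEVELS, read in abc-iut-w6-d070's tempered LEVEL TOPOLOGY — corollary-integrator,
# «topology@D.chart» (proof-only)

Mochizuki, *Semi-graphs of anabelioids*, Publ. RIMS **42** (2006) 221–322, §5 Prop 5.2 (iv) p. 64 ("natural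
exact sequences `1 → Π^temp_𝒢 → Π^temp_𝔊 → Π_A → 1`", the topology of `Π^temp_𝔊`), Rmk 5.3.1 p. 65, Thm 5.4
(i)(ii) p. 66; Prop 3.6 p. 38 ("independent, up to inner automorphism, of the choice of the cofinal system")
[cite: MochizukiSemiAnbd2006, Thm 5.4 (i), p. 66].

PROOF-ONLY file (abc-iut cell, layer L3, sub-DAG `plan/L3/SUBDAG-SemiAnbd-Thm54.md`, producer row T54-B =
`plan/GAP-LEDGER.md` G-w4d053-1; row «T54·COROLLARY-INTEGRATOR» of the L3 lead's α64, split (a)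
«topology@D.chart» agreed with abc-iut-w4-d029 2026-08-26T10:04:19Z; seat abc-iut-w4-d089 gen 6).  No definition,
no new named fact, no producer restated.  abc-iut-w4-d029's
`arithMaximalCompactStatement_outerAction_piPresentation_chart_of_producers` (ArithThm54CapstonesChartOfProducers.lean,
p436631) is Thm 5.4 (i) ∧ (ii) at `E := π₁^temp(𝒢) ⋊^out_{ρ'} Π_A` for the chart `D.chart …` of ANY cofinal
Galois tower `D` with characteristic finite levels, with `hP`, `hKst`, `hLst`, `hnobpNCpt`, `hR`, `hVE` bound —
but with the LEVEL-B TOPOLOGY of `E` still abstract: instance binders `[TopologicalSpace E]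
[IsTopologicalGroup E] [T2Space E]` plus `hT` (tempered), `hb` (abc-iut-L3-d2's neighbourhood basis), `hKopen`
(open tree-level action kernels).  abc-iut-w6-d070's `arithLevelTopology c …` (ArithTemperedGroupLevelTopology.lean)
is GENERIC in the chart `c` and the presentation, so — exactly as abc-iut-w6-d070 did at the canonical chart
(`arithMaximalCompactStatement_outerAction_piPresentation_levelTopology`, p435643) — it instantiates at
`c := D.chart …`, `P := D.piPresentation h𝒢 T R`, tree levels `N n := ker (D.projAut h𝒢 n)` (normal;
antitone `ker_projAut_anti`; open `isOpen_ker_projAut`; cofinal at `1`, `exists_ker_projAut_subset`), their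
Φ-stability `(hKst_and_hLst_of_ker_piLevelAut_eq_charOpenCore …).1` (abc-iut-L3-t9), one compact vertex group
`isCompact_piPresentation_H`, first countability `TemperedPiChart.firstCountableTopology_G` (abc-iut-w6-d070),
and the PRODUCED compatibility `hP := isArithCompatible_piPresentation_outerAction_of_branchPair_chart_of_finite …`
(abc-iut-w4-d053).  The statement keeps ONE instance binder `[inst : TopologicalSpace E]` PINNED by
`hinst : inst = arithLevelTopology (D.chart …) …` (abc-iut-w6-d070's pattern), so that the compactness clause of
(AI4″) `stabBranchPairAug` and the conclusions are read in THIS topology; `[IsTopologicalGroup E]`, `[T2Space E]`,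
`hT`, `hb`, `hKopen` are then the theorems `arithLevelTopology_isTopologicalGroup`, `arithLevelTopology_t2Space`,
`isTempered_arithLevelTopology`, `arithLevelTopology_nhds_hasBasis`, `isOpen_ker_arithAct`.

The package's input `hA : IsTempered Π_A` is DISCHARGED as abc-iut-w6-d085 does at the canonical tower («T54·hA»,
ArithThm54CapstoneCorollaryProfinite.lean): `IsTempered.of_profinite` ([SemiAnbd] Rmk 3.1.1) under the print-faithful
frame `[CompactSpace Π_A] [TotallyDisconnectedSpace Π_A]` (Def 5.1 (i): `Π_A = π̂₁(A)` is PROFINITE).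

HONEST RESIDUAL of `arithMaximalCompactStatement_outerAction_piPresentation_chart_of_producers_levelTopology`:
the profinite frame of `Π_A` (instances), the Def 5.1 (i) / Prop 3.6
(iv) DESIGN data `hV hE hopen hBR` (abc-iut-w4-d082), the characteristic levels `hker` and (I0v) `hfaithV` of the
tower (abc-iut-L3-t9 / abc-iut-w4-d053 — theorems at the characteristic tower `ofCharCores`, split (b) of
abc-iut-w4-d029), the ONE continuity binder `hK1′` (abc-iut-w6-d117 «T54·hK1′»), `noSwitchBase`, `hest`, `hbot`
(print), and (AI4″) `stabBranchPairAug` (abc-iut-w4-d059).  Nothing beyond composition is proved here; typed ≠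
proved for the residual inputs; this is Thm 5.4 for OUR tower decomposition; no side taken on [IUTchIII]
Cor. 3.12.
-/

namespace Literature.AnabelianGeometry.SemiGraphs

namespace ProfiniteSemiGraph

open CategoryTheory Topology Filter
open Literature.AnabelianGeometry.EtaleTheta
open scoped Pointwise

universe u

variable {𝒢 : ProfiniteSemiGraph.{u}} (D : GaloisLevelData 𝒢) (h𝒢 : 𝒢.IsCountable)
  (hcof : ∀ (T : CovObj 𝒢), T.IsTempered → ∀ p : T.Point,
    ∃ i : ℕ, ∀ j, i ≤ j → (D.S j).Splits (T.component p))
  (hcn : 𝒢.graph.IsConnected) (hS : ∀ n, (D.S n).Splits (D.S n)) (hfin : ∀ n, (D.S n).IsFinite)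
  (hne : ∀ n, (D.S n).HasNonemptyFibres)
  (hconn : ∀ (n : ℕ) (p q : (D.S n).Point), (D.S n).SameComponent p q)

/-- **[SemiAnbd] Thm 5.4 (i) ∧ (ii) at `π₁^temp(𝒢) ⋊^out Π_A` for the chart of a cofinal Galois tower with
characteristic levels, in abc-iut-w6-d070's tempered level topology `arithLevelTopology (D.chart …) …`** —
abc-iut-w4-d029's `arithMaximalCompactStatement_outerAction_piPresentation_chart_of_producers` with
`[TopologicalSpace E] := arithLevelTopology …` (pinned by `hinst`) and `[IsTopologicalGroup E]`, `[T2Space E]`,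
`hT`, `hb`, `hKopen` supplied by the `arithLevelTopology` package at the tree levels `ker (D.projAut h𝒢 n)`.
`hA := IsTempered.of_profinite` (`Π_A` profinite, abc-iut-w6-d085's «T54·hA» discharge).  Residual binders:
`hV hE hopen hBR`, `hker`, `hfaithV`, `hK1′`, `noSwitchBase`, `stabBranchPairAug`, `hest`, `hbot`.
[cite: MochizukiSemiAnbd2006, Thm 5.4 (i), p. 66] -/
theorem arithMaximalCompactStatement_outerAction_piPresentation_chart_of_producers_levelTopology
    (h37 : 𝒢.Thm37Hypotheses) (hG : 𝒢.graph.IsGraph) [Finite 𝒢.graph.Vertex] [Finite 𝒢.graph.Branch]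
    [Finite 𝒢.graph.Edge]
    {PA : Type u} [Group PA] [TopologicalSpace PA] [IsTopologicalGroup PA] [CompactSpace PA]
    [TotallyDisconnectedSpace PA]
    (ρ' : PA →* TopOut (D.chart h𝒢 hcof hcn hS hfin hne).G) (baseAct : PA →* Aut 𝒢.graph)
    [inst : TopologicalSpace (outerSemidirectProduct ρ')]
    (T : ∀ w : 𝒢.graph.Vertex, D.PointSeq h𝒢 w) (R : SemiGraph.RefBranches 𝒢.graph)
    (Rc : ChartRepresentatives (D.chart h𝒢 hcof hcn hS hfin hne))
    -- Prop 3.6 (iv) at `ρ_𝔾(a)` / Def 5.1 (i)(c): the DESIGN data of the outer model (abc-iut-w4-d082's currency)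
    (hV : ∀ (a : PA) (v : 𝒢.graph.Vertex) (H : Subgroup (D.chart h𝒢 hcof hcn hS hfin hne).G), H ∈ verticialSubgroups (D.chart h𝒢 hcof hcn hS hfin hne) v →
      ∃ φ : contMulAut (D.chart h𝒢 hcof hcn hS hfin hne).G, TopOut.mk _ φ = ρ' a ∧
        H.map (φ : MulAut (D.chart h𝒢 hcof hcn hS hfin hne).G).toMonoidHom ∈ verticialSubgroups (D.chart h𝒢 hcof hcn hS hfin hne) ((baseAct a).hom.vertexMap v))
    (hE : ∀ (a : PA) (e : 𝒢.graph.Edge) (K : Subgroup (D.chart h𝒢 hcof hcn hS hfin hne).G), K ∈ edgeLikeSubgroups (D.chart h𝒢 hcof hcn hS hfin hne) e →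
      ∃ φ : contMulAut (D.chart h𝒢 hcof hcn hS hfin hne).G, TopOut.mk _ φ = ρ' a ∧
        K.map (φ : MulAut (D.chart h𝒢 hcof hcn hS hfin hne).G).toMonoidHom ∈ edgeLikeSubgroups (D.chart h𝒢 hcof hcn hS hfin hne) ((baseAct a).hom.edgeMap e))
    (hopen : ∃ U : Subgroup PA, IsOpen (U : Set PA) ∧ ∀ a ∈ U,
      (∀ v, (baseAct a).hom.vertexMap v = v) ∧ (∀ e, (baseAct a).hom.edgeMap e = e) ∧
        ∀ b, (baseAct a).hom.branchMap b = b)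
    (hBR : ∀ (a : PA) (b : 𝒢.graph.Branch) (v : 𝒢.graph.Vertex) (hb : 𝒢.graph.abuts b = some v)
      (φ : 𝒢.Gv v →ₜ* (D.chart h𝒢 hcof hcn hS hfin hne).G), IsVerticialHom (D.chart h𝒢 hcof hcn hS hfin hne) v φ →
      ∃ Φ : contMulAut (D.chart h𝒢 hcof hcn hS hfin hne).G, TopOut.mk _ Φ = ρ' a ∧
        ∃ φ' : 𝒢.Gv ((baseAct a).hom.vertexMap v) →ₜ* (D.chart h𝒢 hcof hcn hS hfin hne).G,
          IsVerticialHom (D.chart h𝒢 hcof hcn hS hfin hne) ((baseAct a).hom.vertexMap v) φ' ∧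
          ∃ x' : (D.chart h𝒢 hcof hcn hS hfin hne).G,
            Subgroup.map (Φ : MulAut (D.chart h𝒢 hcof hcn hS hfin hne).G).toMonoidHom φ.toMonoidHom.range =
              Subgroup.map (MulAut.conj x').toMonoidHom φ'.toMonoidHom.range ∧
            Subgroup.map (Φ : MulAut (D.chart h𝒢 hcof hcn hS hfin hne).G).toMonoidHom
                (Subgroup.map φ.toMonoidHom (𝒢.branchSubgroup b v hb)) =
              Subgroup.map (MulAut.conj x').toMonoidHom
                (Subgroup.map φ'.toMonoidHom
                  (𝒢.branchSubgroup ((baseAct a).hom.branchMap b) ((baseAct a).hom.vertexMap v)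
                    ((baseAct a).hom.abuts_branchMap b v hb))))
    (w₀ : 𝒢.graph.Vertex)
    -- CHARACTERISTIC finite levels (abc-iut-L3-t9 E1): `ker π_n` is the characteristic open core of level `d n`
    (d : ℕ → ℕ) (hker : ∀ n, (D.piLevelAut h𝒢 hconn n).ker = charOpenCore (D.temperedPi h𝒢) (d n))
    -- (I0v) for the tower `D`: every `𝒢_v` acts faithfully on the `v`-fibres of the levels (abc-iut-w4-d053's
    -- `faithfulV_ofOpenNormalSeq` at the prescribed open-normal / characteristic tower)
    (hfaithV : ∀ (v : 𝒢.graph.Vertex) (h : 𝒢.Gv v),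
      (∀ (n : ℕ) (x : ((D.S n).SV v).obj.V), ((D.S n).SV v).obj.ρ h x = x) → h = 1)
    -- the ONE continuity binder of the level-B topology (Def 5.1 (i)(c) congruence-continuity; abc-iut-w6-d117
    -- «T54·hK1′»): the images in `Π_A` of abc-iut-L3-d4's arithmetic level kernels are open
    (hK1' : ∀ n, IsOpen ((((D.piPresentation h𝒢 T R).levelKer (isArithCompatible_piPresentation_outerAction_of_branchPair_chart_of_finite D h𝒢 hcof hcn hS hfin hne T R ρ' baseAct h37 hG hV hBR)
        (D.projAut h𝒢 n).ker ((D.hKst_and_hLst_of_ker_piLevelAut_eq_charOpenCore h𝒢 hconn T R ρ' (isArithCompatible_piPresentation_outerAction_of_branchPair_chart_of_finite D h𝒢 hcof hcn hS hfin hne T R ρ' baseAct h37 hG hV hBR) d hker).1 n)).map (outerSemidirectProductSnd ρ') :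
      Subgroup PA) : Set PA))
    -- the topology of `E` IS abc-iut-w6-d070's tempered level topology at the chart of the tower
    (hinst : inst = @arithLevelTopology 𝒢 (D.chart h𝒢 hcof hcn hS hfin hne) PA _ _ _ ρ' baseAct
        (TemperedPiChart.firstCountableTopology_G (D.chart h𝒢 hcof hcn hS hfin hne)) h37.toProp36Hypotheses IsTempered.of_profinite (D.piPresentation h𝒢 T R)
        (isArithCompatible_piPresentation_outerAction_of_branchPair_chart_of_finite D h𝒢 hcof hcn hS hfin hne T R ρ' baseAct h37 hG hV hBR) w₀
        (D.isCompact_piPresentation_H h𝒢 T R w₀) (fun n => (D.projAut h𝒢 n).ker) (fun _ => MonoidHom.normal_ker _)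
        (D.hKst_and_hLst_of_ker_piLevelAut_eq_charOpenCore h𝒢 hconn T R ρ' (isArithCompatible_piPresentation_outerAction_of_branchPair_chart_of_finite D h𝒢 hcof hcn hS hfin hne T R ρ' baseAct h37 hG hV hBR) d hker).1
        (D.ker_projAut_anti h𝒢) (D.isOpen_ker_projAut h𝒢) (fun _ hU => D.exists_ker_projAut_subset h𝒢 hU) hK1')
    (noSwitchBase : NoBranchSwitching 𝒢.graph.edgeOf
      (fun (a : PA) (b : 𝒢.graph.Branch) => (baseAct a).hom.branchMap b))
    (stabBranchPairAug : ∀ (C : Subgroup (outerSemidirectProduct ρ')),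
      IsCompact (C : Set (outerSemidirectProduct ρ')) →
      ∀ (j₀ : ℕ) (w : ∀ i : {i : ℕ // j₀ ≤ i}, ((D.piPresentation h𝒢 T R).cosetGraph (D.piLevelAut h𝒢 hconn i.1).ker).Vertex)
      (β β' : ∀ i : {i : ℕ // j₀ ≤ i}, ((D.piPresentation h𝒢 T R).cosetGraph (D.piLevelAut h𝒢 hconn i.1).ker).Branch),
      (∀ i, β i ≠ β' i ∧ ((D.piPresentation h𝒢 T R).cosetGraph (D.piLevelAut h𝒢 hconn i.1).ker).abuts (β i) = some (w i) ∧
        ((D.piPresentation h𝒢 T R).cosetGraph (D.piLevelAut h𝒢 hconn i.1).ker).abuts (β' i) = some (w i)) →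
      (∀ ⦃i i' : {i : ℕ // j₀ ≤ i}⦄ (h : i.1 ≤ i'.1),
        ((D.piPresentation h𝒢 T R).cosetGraphTrans (D.ker_piLevelAut_anti h𝒢 hconn h)).vertexMap (w i') = w i ∧
        ((D.piPresentation h𝒢 T R).cosetGraphTrans (D.ker_piLevelAut_anti h𝒢 hconn h)).branchMap (β i') = β i ∧
          ((D.piPresentation h𝒢 T R).cosetGraphTrans (D.ker_piLevelAut_anti h𝒢 hconn h)).branchMap (β' i') = β' i) →
      (∀ (i : {i : ℕ // j₀ ≤ i}) (g : outerSemidirectProduct ρ'), g ∈ C →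
        ((D.piPresentation h𝒢 T R).arithAct (isArithCompatible_piPresentation_outerAction_of_branchPair_chart_of_finite D h𝒢 hcof hcn hS hfin hne T R ρ' baseAct h37 hG hV hBR) (D.piLevelAut h𝒢 hconn i.1).ker ((D.hKst_and_hLst_of_ker_piLevelAut_eq_charOpenCore h𝒢 hconn T R ρ' (isArithCompatible_piPresentation_outerAction_of_branchPair_chart_of_finite D h𝒢 hcof hcn hS hfin hne T R ρ' baseAct h37 hG hV hBR) d hker).2 i.1) g).hom.vertexMap (w i) = w i ∧
        ((D.piPresentation h𝒢 T R).arithAct (isArithCompatible_piPresentation_outerAction_of_branchPair_chart_of_finite D h𝒢 hcof hcn hS hfin hne T R ρ' baseAct h37 hG hV hBR) (D.piLevelAut h𝒢 hconn i.1).ker ((D.hKst_and_hLst_of_ker_piLevelAut_eq_charOpenCore h𝒢 hconn T R ρ' (isArithCompatible_piPresentation_outerAction_of_branchPair_chart_of_finite D h𝒢 hcof hcn hS hfin hne T R ρ' baseAct h37 hG hV hBR) d hker).2 i.1) g).hom.branchMap (β i) = β i ∧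
          ((D.piPresentation h𝒢 T R).arithAct (isArithCompatible_piPresentation_outerAction_of_branchPair_chart_of_finite D h𝒢 hcof hcn hS hfin hne T R ρ' baseAct h37 hG hV hBR) (D.piLevelAut h𝒢 hconn i.1).ker ((D.hKst_and_hLst_of_ker_piLevelAut_eq_charOpenCore h𝒢 hconn T R ρ' (isArithCompatible_piPresentation_outerAction_of_branchPair_chart_of_finite D h𝒢 hcof hcn hS hfin hne T R ρ' baseAct h37 hG hV hBR) d hker).2 i.1) g).hom.branchMap (β' i) = β' i) →
      ∃ (v : 𝒢.graph.Vertex) (b b' : 𝒢.graph.Branch) (a : PA) (h : outerSemidirectProduct ρ'),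
        (decompositionDataOfChart Rc (toOuterSemidirectProduct ρ')).abut b = some v ∧ (decompositionDataOfChart Rc (toOuterSemidirectProduct ρ')).abut b' = some v ∧
        h ∈ (decompositionDataOfChart Rc (toOuterSemidirectProduct ρ')).vertGp v ∧ (b' ≠ b ∨ h ∉ (decompositionDataOfChart Rc (toOuterSemidirectProduct ρ')).brGp b) ∧
        C.map (outerSemidirectProductSnd ρ') ≤ conjSubgroup a (((decompositionDataOfChart Rc (toOuterSemidirectProduct ρ')).brGp b ⊓
          conjSubgroup h ((decompositionDataOfChart Rc (toOuterSemidirectProduct ρ')).brGp b')).map (outerSemidirectProductSnd ρ')))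
    (hest : IsTotallyArithEstranged (decompositionDataOfChart Rc (toOuterSemidirectProduct ρ')) (outerSemidirectProductSnd ρ')) (hbot : ¬ IsArithAmple (outerSemidirectProductSnd ρ') ⊥) :
    ArithMaximalCompactStatementI (decompositionDataOfChart Rc (toOuterSemidirectProduct ρ')) (outerSemidirectProductSnd ρ') ∧
      ArithMaximalCompactStatementII (decompositionDataOfChart Rc (toOuterSemidirectProduct ρ')) (outerSemidirectProductSnd ρ') := by
  subst hinst
  haveI hfc : FirstCountableTopology (D.chart h𝒢 hcof hcn hS hfin hne).G := TemperedPiChart.firstCountableTopology_G _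
  letI : TopologicalSpace (outerSemidirectProduct ρ') := @arithLevelTopology 𝒢 (D.chart h𝒢 hcof hcn hS hfin hne) PA _ _ _ ρ' baseAct
        (TemperedPiChart.firstCountableTopology_G (D.chart h𝒢 hcof hcn hS hfin hne)) h37.toProp36Hypotheses IsTempered.of_profinite (D.piPresentation h𝒢 T R)
        (isArithCompatible_piPresentation_outerAction_of_branchPair_chart_of_finite D h𝒢 hcof hcn hS hfin hne T R ρ' baseAct h37 hG hV hBR) w₀
        (D.isCompact_piPresentation_H h𝒢 T R w₀) (fun n => (D.projAut h𝒢 n).ker) (fun _ => MonoidHom.normal_ker _)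
        (D.hKst_and_hLst_of_ker_piLevelAut_eq_charOpenCore h𝒢 hconn T R ρ' (isArithCompatible_piPresentation_outerAction_of_branchPair_chart_of_finite D h𝒢 hcof hcn hS hfin hne T R ρ' baseAct h37 hG hV hBR) d hker).1
        (D.ker_projAut_anti h𝒢) (D.isOpen_ker_projAut h𝒢) (fun _ hU => D.exists_ker_projAut_subset h𝒢 hU) hK1'
  haveI := arithLevelTopology_isTopologicalGroup (D.chart h𝒢 hcof hcn hS hfin hne) ρ' baseAct h37.toProp36Hypotheses IsTempered.of_profinite (D.piPresentation h𝒢 T R)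
      (isArithCompatible_piPresentation_outerAction_of_branchPair_chart_of_finite D h𝒢 hcof hcn hS hfin hne T R ρ' baseAct h37 hG hV hBR) w₀
      (D.isCompact_piPresentation_H h𝒢 T R w₀) (fun n => (D.projAut h𝒢 n).ker) (fun _ => MonoidHom.normal_ker _)
      (D.hKst_and_hLst_of_ker_piLevelAut_eq_charOpenCore h𝒢 hconn T R ρ' (isArithCompatible_piPresentation_outerAction_of_branchPair_chart_of_finite D h𝒢 hcof hcn hS hfin hne T R ρ' baseAct h37 hG hV hBR) d hker).1
      (D.ker_projAut_anti h𝒢) (D.isOpen_ker_projAut h𝒢) (fun _ hU => D.exists_ker_projAut_subset h𝒢 hU) hK1'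
  haveI := arithLevelTopology_t2Space (D.chart h𝒢 hcof hcn hS hfin hne) ρ' baseAct h37.toProp36Hypotheses IsTempered.of_profinite (D.piPresentation h𝒢 T R)
      (isArithCompatible_piPresentation_outerAction_of_branchPair_chart_of_finite D h𝒢 hcof hcn hS hfin hne T R ρ' baseAct h37 hG hV hBR) w₀
      (D.isCompact_piPresentation_H h𝒢 T R w₀) (fun n => (D.projAut h𝒢 n).ker) (fun _ => MonoidHom.normal_ker _)
      (D.hKst_and_hLst_of_ker_piLevelAut_eq_charOpenCore h𝒢 hconn T R ρ' (isArithCompatible_piPresentation_outerAction_of_branchPair_chart_of_finite D h𝒢 hcof hcn hS hfin hne T R ρ' baseAct h37 hG hV hBR) d hker).1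
      (D.ker_projAut_anti h𝒢) (D.isOpen_ker_projAut h𝒢) (fun _ hU => D.exists_ker_projAut_subset h𝒢 hU) hK1'
  exact arithMaximalCompactStatement_outerAction_piPresentation_chart_of_producers D h𝒢 hcof hcn hS hfin hne hconn
    h37 hG ρ' baseAct T R Rc hV hE hopen hBR w₀ d hker hfaithV
    (isTempered_arithLevelTopology (D.chart h𝒢 hcof hcn hS hfin hne) ρ' baseAct h37.toProp36Hypotheses IsTempered.of_profinite (D.piPresentation h𝒢 T R)
      (isArithCompatible_piPresentation_outerAction_of_branchPair_chart_of_finite D h𝒢 hcof hcn hS hfin hne T R ρ' baseAct h37 hG hV hBR) w₀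
      (D.isCompact_piPresentation_H h𝒢 T R w₀) (fun n => (D.projAut h𝒢 n).ker) (fun _ => MonoidHom.normal_ker _)
      (D.hKst_and_hLst_of_ker_piLevelAut_eq_charOpenCore h𝒢 hconn T R ρ' (isArithCompatible_piPresentation_outerAction_of_branchPair_chart_of_finite D h𝒢 hcof hcn hS hfin hne T R ρ' baseAct h37 hG hV hBR) d hker).1
      (D.ker_projAut_anti h𝒢) (D.isOpen_ker_projAut h𝒢) (fun _ hU => D.exists_ker_projAut_subset h𝒢 hU) hK1')
    (arithLevelTopology_nhds_hasBasis (D.chart h𝒢 hcof hcn hS hfin hne) ρ' baseAct h37.toProp36Hypotheses IsTempered.of_profinite (D.piPresentation h𝒢 T R)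
      (isArithCompatible_piPresentation_outerAction_of_branchPair_chart_of_finite D h𝒢 hcof hcn hS hfin hne T R ρ' baseAct h37 hG hV hBR) w₀
      (D.isCompact_piPresentation_H h𝒢 T R w₀) (fun n => (D.projAut h𝒢 n).ker) (fun _ => MonoidHom.normal_ker _)
      (D.hKst_and_hLst_of_ker_piLevelAut_eq_charOpenCore h𝒢 hconn T R ρ' (isArithCompatible_piPresentation_outerAction_of_branchPair_chart_of_finite D h𝒢 hcof hcn hS hfin hne T R ρ' baseAct h37 hG hV hBR) d hker).1
      (D.ker_projAut_anti h𝒢) (D.isOpen_ker_projAut h𝒢) (fun _ hU => D.exists_ker_projAut_subset h𝒢 hU) hK1')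
    hK1'
    (isOpen_ker_arithAct (D.chart h𝒢 hcof hcn hS hfin hne) ρ' baseAct h37.toProp36Hypotheses IsTempered.of_profinite (D.piPresentation h𝒢 T R)
      (isArithCompatible_piPresentation_outerAction_of_branchPair_chart_of_finite D h𝒢 hcof hcn hS hfin hne T R ρ' baseAct h37 hG hV hBR) w₀
      (D.isCompact_piPresentation_H h𝒢 T R w₀) (fun n => (D.projAut h𝒢 n).ker) (fun _ => MonoidHom.normal_ker _)
      (D.hKst_and_hLst_of_ker_piLevelAut_eq_charOpenCore h𝒢 hconn T R ρ' (isArithCompatible_piPresentation_outerAction_of_branchPair_chart_of_finite D h𝒢 hcof hcn hS hfin hne T R ρ' baseAct h37 hG hV hBR) d hker).1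
      (D.ker_projAut_anti h𝒢) (D.isOpen_ker_projAut h𝒢) (fun _ hU => D.exists_ker_projAut_subset h𝒢 hU) hK1')
    noSwitchBase stabBranchPairAug hest hbot

end ProfiniteSemiGraph

end Literature.AnabelianGeometry.SemiGraphs
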